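/-
Copyright (c) 2026 the pub-hodgecm-mathlib formalisation cell (harness21).  Prover seat hodgecm-mathlib-LH4-p14 (g6), 2026-09-04 — STAGE-1b (β-BAL) road, dealer∕pen LH4-plan (g13)
WORD #86: brick (β-BAL-3) = B3 «THE BINARY NORM-FORM CHARACTER COUNT», FILE 2 of 2 (LH4-p11 (g8) SCOPE-betaBAL v1 §2 (iv) ∕ SPEC-B2 §3 (B2b-2); SIG `SIG-B3-…v1` 5f694337).
-/
import Summits.HodgeConjecture.HodgeConjecture.Theorems.F0P3cDyRamBinaryNormFormFixedSums   -- FILE 1 (this seat): (A) full regime, the F-side sums; brings the ★ ω-conductor toolkit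
import HarnessLib

/-!
# Crux `H413`, line LH4 «(D-RAM) FOUR-FRAME», STAGE-1b (β-BAL) — B3 «THE BINARY NORM-FORM CHARACTER COUNT», FILE 2: uniform fibres of the norm on a residue system, regrouping,
# and the closed forms (B) `S_j(s) = 0` (`1 ≤ j ≤ d − 2`) and (C) `(q−1)·S_{d−1}(s) = −ω(C₀)·#R^×`

Cell `hodgecm-mathlib` (D-0151), FLOOR 0, crux item H413 = `stmt-HodgeConjecture-24833`, route `HCCMUnconditional`; squad LH4; lane `--supports stmt-HodgeConjecture-24833 --as helper`.
THEOREMS ONLY (no `def`, no instance, no `sorry`, default heartbeats); pure local arithmetic; COUNT-NEUTRAL.  Carrier (LH4-p11 (g8) (Q2)): an ABSTRACT complete irredundant residue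
system `(R : Finset K) (hR₁ : |r| ≤ 1) (hR₂ : every integral x has a representative mod ϖ^s) (hR₃ : representatives are ϖ^s-apart)` of `𝒪_K`, unit part `R with |r| = 1`; and an
abstract complete irredundant system `A` (resp. `A₀`) of representatives of the fixed units (resp. fixed integral elements) — it only WITNESSES the regrouping.
* §1 (U) `card_filter_norm_near_le` ∕ `card_filter_norm_near_eq` — UNIFORM FIBRES: on the unit part of `R` the fibres `{r : |N r − a| ≤ |ϖ|^{2e}}` (`a` a fixed unit, `1 ≤ e ≤ d − 1`,
  `2e ≤ s`) all have the same cardinality — transitivity with a CONSTANT multiplier `z`, `|a′∕a − N z| ≤ exp(−2(d−1))` (★ toolkit §1: below the break every fixed unit is a norm to order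
  `2(d−1)`), `r ↦ rep(r·z)` injective on `R` (the ★ §5 pattern) — the index-2 ∕ conductor-`d` structure of `N(𝒪_K^×)` read without quotient groups.
* §2 `sum_units_eq_card_mul_sum_of_norm_classes` (generic regrouping `Σ_{R^×} f = #fibre · Σ_A g`), `card_units_eq_card_mul_card_of_norm_classes` (`#R^× = #fibre · #A`),
  `sum_units_normSign_binaryNormForm_eq_card_mul_sum` (the character sum: on the fibre over `a` the term is `ω(C₀ + C₁ϖ_F^j a)` once `d ≤ j + e`), and the closed forms
  **(B) `sum_units_normSign_binaryNormForm_eq_zero`**: `1 ≤ j ≤ d − 2`, `2(d − j) ≤ s` ⇒ `Σ_{r ∈ R, |r|=1} ω(C₀ + C₁ϖ_F^jN r) = 0`;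
  **(C) `card_mul_sum_units_normSign_binaryNormForm_conductor`**: `j = d − 1`, `2 ≤ s` ⇒ `#{a ∈ A₀ : |a| = 1} · Σ_{R^×} ω(C₀ + C₁ϖ_F^{d−1}N r) = −ω(C₀) · #R^×` (`q − 1` unit classes,
  `card_filter_not_unit_eq_one`: one zero class), i.e. `S_{d−1}(s) = −ω(C₀)·q^{s−1}` when `#R^× = (q−1)q^{s−1}`.
LEFT for the SIG's part 2 (next hand): the `j = 0` conic count and the all-residues recursion `T_j(s) = S_j(s) + T_{j+1}(s−1)`.
HONEST LABEL.  Count-neutral; (β-BAL), (A″), (β), T₊ stay OPEN; HC_CM is proved only modulo the 7 printed citations (2 remaining named inputs: hLiu418 = `stmt-HodgeConjecture-24832`,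
h413 = `stmt-HodgeConjecture-24833`) until rung 0 closes.

## References
* [Serre1979] J.-P. Serre, *Local Fields*, GTM 67 (1979) — Ch. V §3 Prop. 5, Cor. 2–3, Ch. XV §2.
* [NeukirchANT1999] J. Neukirch, *Algebraic Number Theory* (1999) — Ch. V (1.3).
-/

set_option autoImplicit false

noncomputable section

namespace Summit.HodgeConjecture.HodgeConjecture.Cruxes.H413.F0P3cDyRamBinaryNormFormCharCount

open WithZero
open scoped Valued
open Literature.NumberTheory.Automorphic.UnitaryThreeFourFrame
open Literature.NumberTheory.LocalFields.WildQuadraticDatum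
open Summit.HodgeConjecture.HodgeConjecture.Cruxes.H413.F0P3cDyRamBinaryNormFormFixedSums

variable {K : Type} [Field K] [Valued K ℤᵐ⁰] {σ : K →+* K} {ϖ : K} {d t : ℕ}

/-! ## §1  (U) Uniform fibres of the norm on the unit part of a residue system -/

/-- ONE-SIDED TRANSPORT.  `R` a complete irredundant residue system of `𝒪_K` modulo `ϖ^s` (`|r| ≤ 1`; every integral `x` has a representative; distinct representatives are
`ϖ^s`-apart), `a, a′` fixed units, `e + 1 ≤ d`, `1 ≤ e`, `2e ≤ s`: there is an INJECTION of `{r ∈ R : |r| = 1, |N r − a| ≤ |ϖ|^{2e}}` into `{r ∈ R : |r| = 1, |N r − a′| ≤ |ϖ|^{2e}}` —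
`r ↦ rep(r·z)` with a constant unit `z`, `|a′∕a − N z| ≤ exp(−2(d−1))` (★ toolkit §1: below the break every fixed unit is a norm to order `2(d−1)`). [cite: Serre1979, Ch. V §3 Cor. 2–3] -/
theorem card_filter_norm_near_le [CompleteSpace K] [Finite 𝓀[K]] (hD : IsRamifiedQuadraticDatum σ ϖ d t) (h2v : Valued.v (2 : K) < 1)
    {e s : ℕ} (hed : e + 1 ≤ d) (he : 1 ≤ e) (hes : 2 * e ≤ s)
    (R : Finset K) (hR₁ : ∀ r ∈ R, Valued.v r ≤ 1) (hR₂ : ∀ x : K, Valued.v x ≤ 1 → ∃ r ∈ R, Valued.v (x - r) ≤ Valued.v ϖ ^ s)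
    (hR₃ : ∀ r ∈ R, ∀ r' ∈ R, Valued.v (r - r') ≤ Valued.v ϖ ^ s → r = r')
    {a a' : K} (hσa : σ a = a) (ha : Valued.v a = 1) (hσa' : σ a' = a') (ha' : Valued.v a' = 1) :
    (R.filter fun r => Valued.v r = 1 ∧ Valued.v (r * σ r - a) ≤ Valued.v ϖ ^ (2 * e)).card ≤
      (R.filter fun r => Valued.v r = 1 ∧ Valued.v (r * σ r - a') ≤ Valued.v ϖ ^ (2 * e)).card := by
  classical
  obtain ⟨hσ, hvσ, hϖ, -, -, -, -⟩ := id hD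
  have hϖ1 : Valued.v ϖ ≤ 1 := by rw [hϖ, ← exp_zero]; exact exp_le_exp.2 (by norm_num)
  have ha0 : a ≠ 0 := fun h => by rw [h, map_zero] at ha; exact zero_ne_one ha
  -- the constant multiplier `z`: `|a'/a − N z| ≤ exp(−2(d−1)) ≤ |ϖ|^{2e}`
  have hσq : σ (a' / a) = a' / a := by rw [map_div₀, hσa, hσa']
  have hq1 : Valued.v (a' / a) = 1 := by rw [map_div₀, ha, ha', div_one]
  obtain ⟨z, hz1, hz⟩ := exists_unit_v_sub_mul_map_le hD h2v hσq hq1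
  have hz' : Valued.v (a' / a - z * σ z) ≤ Valued.v ϖ ^ (2 * e) := by
    refine hz.trans ?_
    rw [hϖ, ← exp_nsmul, nsmul_eq_mul, mul_neg, mul_one]
    exact exp_le_exp.2 (by push_cast; omega)
  -- the representative map
  have hrep : ∀ r ∈ R, ∃ r' ∈ R, Valued.v (r * z - r') ≤ Valued.v ϖ ^ s := fun r hr =>
    hR₂ (r * z) (by rw [map_mul, hz1, mul_one]; exact hR₁ r hr)
  choose! φ hφR hφ using hrep
  refine Finset.card_le_card_of_injOn φ (fun r hr => ?_) (fun r₁ hr₁ r₂ hr₂ h => ?_)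
  · -- `φ r` lies in the `a'`-fibre
    rw [Finset.mem_coe, Finset.mem_filter] at hr ⊢
    obtain ⟨hrR, hr1, hra⟩ := hr
    refine ⟨hφR r hrR, ?_, ?_⟩
    · -- `|φ r| = 1`: `φ r = r z − (r z − φ r)` with `|r z| = 1 > |ϖ|^s ≥ |r z − φ r|`
      have hrz : Valued.v (r * z) = 1 := by rw [map_mul, hr1, hz1, one_mul]
      have hlt : Valued.v (r * z - φ r) < Valued.v (r * z) := by
        rw [hrz]
        refine lt_of_le_of_lt (hφ r hrR) ?_
        rw [hϖ, ← exp_nsmul, nsmul_eq_mul, mul_neg, mul_one, ← exp_zero]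
        exact exp_lt_exp.2 (by omega)
      have hlt' : Valued.v (φ r - r * z) < Valued.v (r * z) := by rwa [← Valuation.map_neg, neg_sub]
      have e1 : φ r = r * z + (φ r - r * z) := by ring
      rw [e1, Valuation.map_add_eq_of_lt_left _ hlt', hrz]
    · -- `|N(φ r) − a'| ≤ |ϖ|^{2e}`
      set δ := φ r - r * z with hδ
      have hvδ : Valued.v δ ≤ Valued.v ϖ ^ s := by rw [hδ, ← Valuation.map_neg, neg_sub]; exact hφ r hrR
      have hvδ' : Valued.v δ ≤ Valued.v ϖ ^ (2 * e) := hvδ.trans (pow_le_pow_right_of_le_one' hϖ1 hes)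
      have hN : φ r * σ (φ r) - a' =
          (r * σ r - a) * (z * σ z) - a * (a' / a - z * σ z) + ((r * z) * σ δ + σ (r * z) * δ + δ * σ δ) := by
        have e2 : φ r = r * z + δ := by rw [hδ]; ring
        rw [e2, map_add, map_mul]
        field_simp
        ring
      rw [hN]
      have hv1 : Valued.v ((r * σ r - a) * (z * σ z)) ≤ Valued.v ϖ ^ (2 * e) := by
        rw [map_mul, map_mul, hvσ, hz1, mul_one, mul_one]; exact hra
      have hv2 : Valued.v (a * (a' / a - z * σ z)) ≤ Valued.v ϖ ^ (2 * e) := by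
        rw [map_mul, ha, one_mul]; exact hz'
      have hv3 : Valued.v ((r * z) * σ δ + σ (r * z) * δ + δ * σ δ) ≤ Valued.v ϖ ^ (2 * e) := by
        have hrz1 : Valued.v (r * z) ≤ 1 := by rw [map_mul, hr1, hz1, one_mul]
        refine (Valuation.map_add _ _ _).trans (max_le ((Valuation.map_add _ _ _).trans (max_le ?_ ?_)) ?_)
        · rw [map_mul, hvσ]; exact (mul_le_of_le_one_left' hrz1).trans hvδ'
        · rw [map_mul, hvσ]; exact (mul_le_of_le_one_left' hrz1).trans hvδ'
        · rw [map_mul, hvσ]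
          exact (mul_le_of_le_one_right' (hvδ.trans (pow_le_one₀ zero_le hϖ1))).trans hvδ'
      exact (Valuation.map_add _ _ _).trans (max_le ((Valuation.map_sub _ _ _).trans (max_le hv1 hv2)) hv3)
  · -- injectivity
    rw [Finset.mem_coe, Finset.mem_filter] at hr₁ hr₂
    have hz0 : z ≠ 0 := fun h0 => by rw [h0, map_zero] at hz1; exact zero_ne_one hz1
    refine hR₃ r₁ hr₁.1 r₂ hr₂.1 ?_
    have e3 : r₁ - r₂ = z⁻¹ * ((r₁ * z - φ r₁) - (r₂ * z - φ r₂)) := by rw [h]; field_simp; ring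
    rw [e3, map_mul, map_inv₀, hz1, inv_one, one_mul]
    exact (Valuation.map_sub _ _ _).trans (max_le (hφ r₁ hr₁.1) (hφ r₂ hr₂.1))

/-- **(U) UNIFORM FIBRES OF THE NORM ON RESIDUES.**  Under the hypotheses of `card_filter_norm_near_le`, the two fibres have the SAME cardinality (apply the one-sided transport both
ways): the norm residues of the units of `𝒪_K ⧸ ϖ^s` are equidistributed over the fixed unit classes modulo `|ϖ|^{2e}` for every `e ≤ d − 1` — the index-2 ∕ conductor-`d` structure of
`N(𝒪_K^×)` read without quotient groups. [cite: Serre1979, Ch. V §3 Cor. 2–3] [cite: NeukirchANT1999, Ch. V (1.3)] -/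
theorem card_filter_norm_near_eq [CompleteSpace K] [Finite 𝓀[K]] (hD : IsRamifiedQuadraticDatum σ ϖ d t) (h2v : Valued.v (2 : K) < 1)
    {e s : ℕ} (hed : e + 1 ≤ d) (he : 1 ≤ e) (hes : 2 * e ≤ s)
    (R : Finset K) (hR₁ : ∀ r ∈ R, Valued.v r ≤ 1) (hR₂ : ∀ x : K, Valued.v x ≤ 1 → ∃ r ∈ R, Valued.v (x - r) ≤ Valued.v ϖ ^ s)
    (hR₃ : ∀ r ∈ R, ∀ r' ∈ R, Valued.v (r - r') ≤ Valued.v ϖ ^ s → r = r')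
    {a a' : K} (hσa : σ a = a) (ha : Valued.v a = 1) (hσa' : σ a' = a') (ha' : Valued.v a' = 1) :
    (R.filter fun r => Valued.v r = 1 ∧ Valued.v (r * σ r - a) ≤ Valued.v ϖ ^ (2 * e)).card =
      (R.filter fun r => Valued.v r = 1 ∧ Valued.v (r * σ r - a') ≤ Valued.v ϖ ^ (2 * e)).card :=
  le_antisymm (card_filter_norm_near_le hD h2v hed he hes R hR₁ hR₂ hR₃ hσa ha hσa' ha')
    (card_filter_norm_near_le hD h2v hed he hes R hR₁ hR₂ hR₃ hσa' ha' hσa ha)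

/-! ## §2  From the residues of `K` to the fixed unit classes: regrouping by the uniform fibres, and the two regimes (B), (C) -/

/-- **REGROUPING (generic).**  `R` a complete irredundant residue system of `𝒪_K` mod `ϖ^s`, `A` a complete irredundant system of representatives of the fixed UNITS modulo
`|ϖ|^{2e}` (`1 ≤ e`, `e + 1 ≤ d`, `2e ≤ s`), `a₀ ∈ A`; `f` on residues and `g` on classes with `f r = g a` whenever `|N r − a| ≤ |ϖ|^{2e}`.  Then
**`Σ_{r ∈ R, |r|=1} f r = #{r ∈ R : |r| = 1, |N r − a₀| ≤ |ϖ|^{2e}} · Σ_{a ∈ A} g a`** — every unit residue has exactly one class, and all fibres have the cardinality of the one over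
`a₀` (§3). [cite: Serre1979, Ch. V §3 Cor. 3] [cite: NeukirchANT1999, Ch. V (1.3)] -/
theorem sum_units_eq_card_mul_sum_of_norm_classes [CompleteSpace K] [Finite 𝓀[K]] (hD : IsRamifiedQuadraticDatum σ ϖ d t) (h2v : Valued.v (2 : K) < 1)
    {e s : ℕ} (hed : e + 1 ≤ d) (he : 1 ≤ e) (hes : 2 * e ≤ s)
    (R : Finset K) (hR₁ : ∀ r ∈ R, Valued.v r ≤ 1) (hR₂ : ∀ x : K, Valued.v x ≤ 1 → ∃ r ∈ R, Valued.v (x - r) ≤ Valued.v ϖ ^ s)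
    (hR₃ : ∀ r ∈ R, ∀ r' ∈ R, Valued.v (r - r') ≤ Valued.v ϖ ^ s → r = r')
    (A : Finset K) (hA₁ : ∀ a ∈ A, σ a = a ∧ Valued.v a = 1)
    (hA₂ : ∀ u : K, σ u = u → Valued.v u = 1 → ∃ a ∈ A, Valued.v (u - a) ≤ Valued.v ϖ ^ (2 * e))
    (hA₃ : ∀ a ∈ A, ∀ a' ∈ A, Valued.v (a - a') ≤ Valued.v ϖ ^ (2 * e) → a = a') {a₀ : K} (ha₀ : a₀ ∈ A)
    (f g : K → ℤ) (hfg : ∀ r ∈ R, ∀ a ∈ A, Valued.v r = 1 → Valued.v (r * σ r - a) ≤ Valued.v ϖ ^ (2 * e) → f r = g a) :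
    ∑ r ∈ R with Valued.v r = 1, f r =
      ((R.filter fun r => Valued.v r = 1 ∧ Valued.v (r * σ r - a₀) ≤ Valued.v ϖ ^ (2 * e)).card : ℤ) * ∑ a ∈ A, g a := by
  classical
  obtain ⟨hσ, hvσ, -, -, -, -, -⟩ := id hD
  have hNσ : ∀ r : K, σ (r * σ r) = r * σ r := fun r => by rw [map_mul, hσ, mul_comm]
  have hN1 : ∀ r : K, Valued.v r = 1 → Valued.v (r * σ r) = 1 := fun r hr => by rw [map_mul, hvσ, hr, mul_one]
  -- the class map `τ`
  have hτ : ∀ r : K, ∃ a : K, Valued.v r = 1 → a ∈ A ∧ Valued.v (r * σ r - a) ≤ Valued.v ϖ ^ (2 * e) := by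
    intro r
    by_cases hr : Valued.v r = 1
    · obtain ⟨a, ha, h⟩ := hA₂ (r * σ r) (hNσ r) (hN1 r hr); exact ⟨a, fun _ => ⟨ha, h⟩⟩
    · exact ⟨0, fun h => absurd h hr⟩
  choose τ hτ using hτ
  set Ru := R.filter (fun r => Valued.v r = 1) with hRu
  have hmaps : ∀ r ∈ Ru, τ r ∈ A := fun r hr => (hτ r (Finset.mem_filter.1 hr).2).1
  -- the fibre of `τ` over `a ∈ A` is the norm-neighbourhood of `a`
  have hfib : ∀ a ∈ A, (Ru.filter fun r => τ r = a) = R.filter (fun r => Valued.v r = 1 ∧ Valued.v (r * σ r - a) ≤ Valued.v ϖ ^ (2 * e)) := by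
    intro a ha
    ext r
    simp only [hRu, Finset.mem_filter, and_assoc]
    constructor
    · rintro ⟨hrR, hr1, rfl⟩; exact ⟨hrR, hr1, (hτ r hr1).2⟩
    · rintro ⟨hrR, hr1, hra⟩
      refine ⟨hrR, hr1, hA₃ _ (hτ r hr1).1 _ ha ?_⟩
      rw [show τ r - a = (r * σ r - a) - (r * σ r - τ r) by ring]
      exact (Valuation.map_sub _ _ _).trans (max_le hra (hτ r hr1).2)
  rw [← Finset.sum_fiberwise_of_maps_to hmaps, Finset.mul_sum]
  refine Finset.sum_congr rfl fun a ha => ?_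
  have hconst : ∀ r ∈ Ru.filter (fun r => τ r = a), f r = g a := by
    intro r hr
    rw [hfib a ha, Finset.mem_filter] at hr
    exact hfg r hr.1 a ha hr.2.1 hr.2.2
  rw [Finset.sum_congr rfl hconst, Finset.sum_const, nsmul_eq_mul, hfib a ha,
    card_filter_norm_near_eq hD h2v hed he hes R hR₁ hR₂ hR₃ (hA₁ a ha).1 (hA₁ a ha).2 (hA₁ a₀ ha₀).1 (hA₁ a₀ ha₀).2]

/-- **COUNTING.**  Under the same hypotheses, **`#{r ∈ R : |r| = 1} = #{r ∈ R : |r| = 1, |N r − a₀| ≤ |ϖ|^{2e}} · #A`** (the generic regrouping at `f = g = 1`). [cite: NeukirchANT1999, Ch. V (1.3)] -/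
theorem card_units_eq_card_mul_card_of_norm_classes [CompleteSpace K] [Finite 𝓀[K]] (hD : IsRamifiedQuadraticDatum σ ϖ d t) (h2v : Valued.v (2 : K) < 1)
    {e s : ℕ} (hed : e + 1 ≤ d) (he : 1 ≤ e) (hes : 2 * e ≤ s)
    (R : Finset K) (hR₁ : ∀ r ∈ R, Valued.v r ≤ 1) (hR₂ : ∀ x : K, Valued.v x ≤ 1 → ∃ r ∈ R, Valued.v (x - r) ≤ Valued.v ϖ ^ s)
    (hR₃ : ∀ r ∈ R, ∀ r' ∈ R, Valued.v (r - r') ≤ Valued.v ϖ ^ s → r = r')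
    (A : Finset K) (hA₁ : ∀ a ∈ A, σ a = a ∧ Valued.v a = 1)
    (hA₂ : ∀ u : K, σ u = u → Valued.v u = 1 → ∃ a ∈ A, Valued.v (u - a) ≤ Valued.v ϖ ^ (2 * e))
    (hA₃ : ∀ a ∈ A, ∀ a' ∈ A, Valued.v (a - a') ≤ Valued.v ϖ ^ (2 * e) → a = a') {a₀ : K} (ha₀ : a₀ ∈ A) :
    ((R.filter fun r => Valued.v r = 1).card : ℤ) =
      ((R.filter fun r => Valued.v r = 1 ∧ Valued.v (r * σ r - a₀) ≤ Valued.v ϖ ^ (2 * e)).card : ℤ) * A.card := by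
  have h := sum_units_eq_card_mul_sum_of_norm_classes hD h2v hed he hes R hR₁ hR₂ hR₃ A hA₁ hA₂ hA₃ ha₀ (fun _ => 1) (fun _ => 1) (fun _ _ _ _ _ _ => rfl)
  simpa using h

/-- **REGROUPING OF THE CHARACTER SUM.**  `C₀, C₁` fixed units, `d ≤ j + e`: on the fibre over `a` the term `ω(C₀ + C₁ϖ_F^jN r)` equals `ω(C₀ + C₁ϖ_F^j a)`
(`|C₁ϖ_F^j(N r − a)| ≤ |ϖ|^{2j+2e} ≤ |ϖ|^{2d−1}`, ★ `normSign_eq_of_near`), so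
**`Σ_{r ∈ R, |r|=1} ω(C₀ + C₁ϖ_F^jN r) = #{r ∈ R : |r| = 1, |N r − a₀| ≤ |ϖ|^{2e}} · Σ_{a ∈ A} ω(C₀ + C₁ϖ_F^j a)`**. [cite: Serre1979, Ch. V §3 Cor. 3; Ch. XV §2] -/
theorem sum_units_normSign_binaryNormForm_eq_card_mul_sum [CompleteSpace K] [Finite 𝓀[K]] (hD : IsRamifiedQuadraticDatum σ ϖ d t) (h2v : Valued.v (2 : K) < 1)
    {C₀ C₁ : K} (hσC₀ : σ C₀ = C₀) (hC₀ : Valued.v C₀ = 1) (hσC₁ : σ C₁ = C₁) (hC₁ : Valued.v C₁ = 1)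
    {j e s : ℕ} (hje : d ≤ j + e) (hed : e + 1 ≤ d) (he : 1 ≤ e) (hes : 2 * e ≤ s)
    (R : Finset K) (hR₁ : ∀ r ∈ R, Valued.v r ≤ 1) (hR₂ : ∀ x : K, Valued.v x ≤ 1 → ∃ r ∈ R, Valued.v (x - r) ≤ Valued.v ϖ ^ s)
    (hR₃ : ∀ r ∈ R, ∀ r' ∈ R, Valued.v (r - r') ≤ Valued.v ϖ ^ s → r = r')
    (A : Finset K) (hA₁ : ∀ a ∈ A, σ a = a ∧ Valued.v a = 1)
    (hA₂ : ∀ u : K, σ u = u → Valued.v u = 1 → ∃ a ∈ A, Valued.v (u - a) ≤ Valued.v ϖ ^ (2 * e))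
    (hA₃ : ∀ a ∈ A, ∀ a' ∈ A, Valued.v (a - a') ≤ Valued.v ϖ ^ (2 * e) → a = a') {a₀ : K} (ha₀ : a₀ ∈ A) :
    ∑ r ∈ R with Valued.v r = 1, normSign σ (C₀ + C₁ * (ϖ * σ ϖ) ^ j * (r * σ r)) =
      ((R.filter fun r => Valued.v r = 1 ∧ Valued.v (r * σ r - a₀) ≤ Valued.v ϖ ^ (2 * e)).card : ℤ) *
        ∑ a ∈ A, normSign σ (C₀ + C₁ * (ϖ * σ ϖ) ^ j * a) := by
  obtain ⟨hσ, hvσ, hϖ, -, -, -, -⟩ := id hD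
  have hϖ1 : Valued.v ϖ ≤ 1 := by rw [hϖ, ← exp_zero]; exact exp_le_exp.2 (by norm_num)
  have hP : Valued.v (C₁ * (ϖ * σ ϖ) ^ j) = Valued.v ϖ ^ (2 * j) := by
    rw [map_mul, hC₁, one_mul, map_pow, map_mul, hvσ, ← pow_two, ← pow_mul]
  have hσP : σ (C₁ * (ϖ * σ ϖ) ^ j) = C₁ * (ϖ * σ ϖ) ^ j := by rw [map_mul, map_pow, map_mul, hσ, hσC₁, mul_comm (σ ϖ) ϖ]
  refine sum_units_eq_card_mul_sum_of_norm_classes hD h2v hed he hes R hR₁ hR₂ hR₃ A hA₁ hA₂ hA₃ ha₀ _ _ fun r _ a ha hr1 hra => ?_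
  obtain ⟨hσa, ha1⟩ := hA₁ a ha
  have hga1 : Valued.v (C₀ + C₁ * (ϖ * σ ϖ) ^ j * a) = 1 := by
    have hlt : Valued.v (C₁ * (ϖ * σ ϖ) ^ j * a) < Valued.v C₀ := by
      rw [map_mul, hP, ha1, mul_one, hC₀, hϖ, ← exp_nsmul, nsmul_eq_mul, mul_neg, mul_one, ← exp_zero]
      exact exp_lt_exp.2 (by omega)
    rw [Valuation.map_add_eq_of_lt_left _ hlt, hC₀]
  refine normSign_eq_of_near hD ?_ (map_binaryNormForm hσ hσC₀ hσC₁ j r) hga1 (n := 2 * d - 1) le_rfl ?_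
  · rw [map_add, hσC₀, map_mul, hσP, hσa]
  · have hsw : Valued.v (a - r * σ r) = Valued.v (r * σ r - a) := Valuation.map_sub_swap _ _ _
    rw [show C₀ + C₁ * (ϖ * σ ϖ) ^ j * a - (C₀ + C₁ * (ϖ * σ ϖ) ^ j * (r * σ r)) = C₁ * (ϖ * σ ϖ) ^ j * (a - r * σ r) by ring, map_mul, hP, hsw]
    calc Valued.v ϖ ^ (2 * j) * Valued.v (r * σ r - a) ≤ Valued.v ϖ ^ (2 * j) * Valued.v ϖ ^ (2 * e) := mul_le_mul' le_rfl hra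
      _ = Valued.v ϖ ^ (2 * j + 2 * e) := (pow_add _ _ _).symm
      _ ≤ Valued.v ϖ ^ (2 * d - 1) := pow_le_pow_right_of_le_one' hϖ1 (by omega)

/-- **(B) THE «ZERO» REGIME.**  Ramified datum on a complete `K` with finite residue field, `|2| < 1`; `C₀, C₁` fixed units; `1 ≤ j`, `j + 2 ≤ d`; `R` a complete irredundant residue
system of `𝒪_K` modulo `ϖ^s` with `2(d − j) ≤ s`; `A` any complete irredundant system of representatives of the fixed units modulo `|ϖ|^{2(d−j)}` (a carrier for the fixed unit
classes; it only WITNESSES the regrouping).  Then **`Σ_{r ∈ R, |r| = 1} ω(C₀ + C₁ϖ_F^j N r) = 0`** (§5 regrouping ∘ §4). [cite: Serre1979, Ch. V §3 Cor. 3; Ch. XV §2] -/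
theorem sum_units_normSign_binaryNormForm_eq_zero [CompleteSpace K] [Finite 𝓀[K]] (hD : IsRamifiedQuadraticDatum σ ϖ d t) (h2v : Valued.v (2 : K) < 1)
    {C₀ C₁ : K} (hσC₀ : σ C₀ = C₀) (hC₀ : Valued.v C₀ = 1) (hσC₁ : σ C₁ = C₁) (hC₁ : Valued.v C₁ = 1)
    {j s : ℕ} (hj : 1 ≤ j) (hjd : j + 2 ≤ d) (hs : 2 * (d - j) ≤ s)
    (R : Finset K) (hR₁ : ∀ r ∈ R, Valued.v r ≤ 1) (hR₂ : ∀ x : K, Valued.v x ≤ 1 → ∃ r ∈ R, Valued.v (x - r) ≤ Valued.v ϖ ^ s)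
    (hR₃ : ∀ r ∈ R, ∀ r' ∈ R, Valued.v (r - r') ≤ Valued.v ϖ ^ s → r = r')
    (A : Finset K) (hA₁ : ∀ a ∈ A, σ a = a ∧ Valued.v a = 1)
    (hA₂ : ∀ u : K, σ u = u → Valued.v u = 1 → ∃ a ∈ A, Valued.v (u - a) ≤ Valued.v ϖ ^ (2 * (d - j)))
    (hA₃ : ∀ a ∈ A, ∀ a' ∈ A, Valued.v (a - a') ≤ Valued.v ϖ ^ (2 * (d - j)) → a = a') :
    ∑ r ∈ R with Valued.v r = 1, normSign σ (C₀ + C₁ * (ϖ * σ ϖ) ^ j * (r * σ r)) = 0 := by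
  classical
  by_cases hA : A = ∅
  · -- no fixed unit class ⇒ no unit residue (the norm of a unit residue would need a class)
    have hRu : R.filter (fun r => Valued.v r = 1) = ∅ := by
      refine Finset.filter_eq_empty_iff.2 fun r hr hr1 => ?_
      obtain ⟨a, ha, -⟩ := hA₂ (r * σ r) (by rw [map_mul, hD.1, mul_comm]) (by rw [map_mul, hD.2.1, hr1, mul_one])
      rw [hA] at ha; exact absurd ha (Finset.notMem_empty a)
    rw [hRu, Finset.sum_empty]
  · obtain ⟨a₀, ha₀⟩ := Finset.nonempty_iff_ne_empty.2 hA
    rw [sum_units_normSign_binaryNormForm_eq_card_mul_sum hD h2v hσC₀ hC₀ hσC₁ hC₁ (e := d - j) (by omega) (by omega) (by omega) hs R hR₁ hR₂ hR₃ A hA₁ hA₂ hA₃ ha₀,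
      sum_normSign_affine_repr_eq_zero hD h2v hσC₀ hC₀ hσC₁ hC₁ hj hjd A hA₁ hA₂ hA₃, mul_zero]

/-- In a complete irredundant system of representatives of the fixed INTEGRAL elements modulo `|ϖ|²` there is EXACTLY ONE non-unit (the class of `0`: fixed elements have even
valuation, so a fixed non-unit is `≡ 0 (mod ϖ²)`). [cite: Serre1979, Ch. V §3] -/
theorem card_filter_not_unit_eq_one (hD : IsRamifiedQuadraticDatum σ ϖ d t)
    (A₀ : Finset K) (hA₁ : ∀ a ∈ A₀, σ a = a ∧ Valued.v a ≤ 1)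
    (hA₂ : ∀ u : K, σ u = u → Valued.v u ≤ 1 → ∃ a ∈ A₀, Valued.v (u - a) ≤ Valued.v ϖ ^ 2)
    (hA₃ : ∀ a ∈ A₀, ∀ a' ∈ A₀, Valued.v (a - a') ≤ Valued.v ϖ ^ 2 → a = a') :
    (A₀.filter fun a => ¬ Valued.v a = 1).card = 1 := by
  classical
  obtain ⟨-, -, hϖ, hfix, -, -, -⟩ := id hD
  have hsmall : ∀ a ∈ A₀, ¬ Valued.v a = 1 → Valued.v a ≤ Valued.v ϖ ^ 2 := by
    intro a ha ha1
    obtain ⟨hσa, hale⟩ := hA₁ a ha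
    by_cases ha0 : a = 0
    · rw [ha0, map_zero]; exact zero_le
    · obtain ⟨n, hn⟩ := hfix a hσa ha0
      rw [hn] at hale ha1 ⊢
      have hn0 : 2 * n ≤ 0 := by rwa [← exp_zero, exp_le_exp] at hale
      have hn1 : 2 * n ≠ 0 := fun h => ha1 (by rw [h, exp_zero])
      rw [hϖ, ← exp_nsmul, nsmul_eq_mul]
      exact exp_le_exp.2 (by omega)
  obtain ⟨z, hz, hz0⟩ := hA₂ 0 (map_zero σ) (by rw [map_zero]; exact zero_le)
  rw [zero_sub, Valuation.map_neg] at hz0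
  have hz1 : ¬ Valued.v z = 1 := fun h => by
    rw [h, hϖ, ← exp_nsmul, nsmul_eq_mul, ← exp_zero, exp_le_exp] at hz0; norm_num at hz0
  rw [Finset.card_eq_one]
  refine ⟨z, Finset.eq_singleton_iff_unique_mem.2 ⟨Finset.mem_filter.2 ⟨hz, hz1⟩, fun a ha => ?_⟩⟩
  rw [Finset.mem_filter] at ha
  exact hA₃ a ha.1 z hz ((Valuation.map_sub _ _ _).trans (max_le (hsmall a ha.1 ha.2) hz0))

/-- **(C) ACROSS THE CONDUCTOR (`j = d − 1`).**  Ramified datum on a complete `K` with finite residue field, `|2| < 1`, `2 ≤ d`; `C₀, C₁` fixed units; `R` a complete irredundant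
residue system of `𝒪_K` modulo `ϖ^s`, `2 ≤ s`; `A₀` any complete irredundant system of representatives of the fixed integral elements modulo `|ϖ|²` (`q − 1` unit classes + the
zero class).  Then **`#{a ∈ A₀ : |a| = 1} · Σ_{r ∈ R, |r|=1} ω(C₀ + C₁ϖ_F^{d−1}N r) = −ω(C₀) · #{r ∈ R : |r| = 1}`** — i.e. `S_{d−1}(s) = −ω(C₀)·q^{s−1}` for
`#R^× = (q−1)q^{s−1}` («across the conductor»): §5 regrouping at `e = 1` ∘ §4 (unit part `= −ω(C₀)`, one zero class). [cite: Serre1979, Ch. V §3 Cor. 3; Ch. XV §2] -/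
theorem card_mul_sum_units_normSign_binaryNormForm_conductor [CompleteSpace K] [Finite 𝓀[K]] (hD : IsRamifiedQuadraticDatum σ ϖ d t) (h2v : Valued.v (2 : K) < 1)
    {C₀ C₁ : K} (hσC₀ : σ C₀ = C₀) (hC₀ : Valued.v C₀ = 1) (hσC₁ : σ C₁ = C₁) (hC₁ : Valued.v C₁ = 1) (hd : 2 ≤ d) {s : ℕ} (hs : 2 ≤ s)
    (R : Finset K) (hR₁ : ∀ r ∈ R, Valued.v r ≤ 1) (hR₂ : ∀ x : K, Valued.v x ≤ 1 → ∃ r ∈ R, Valued.v (x - r) ≤ Valued.v ϖ ^ s)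
    (hR₃ : ∀ r ∈ R, ∀ r' ∈ R, Valued.v (r - r') ≤ Valued.v ϖ ^ s → r = r')
    (A₀ : Finset K) (hA₁ : ∀ a ∈ A₀, σ a = a ∧ Valued.v a ≤ 1)
    (hA₂ : ∀ u : K, σ u = u → Valued.v u ≤ 1 → ∃ a ∈ A₀, Valued.v (u - a) ≤ Valued.v ϖ ^ 2)
    (hA₃ : ∀ a ∈ A₀, ∀ a' ∈ A₀, Valued.v (a - a') ≤ Valued.v ϖ ^ 2 → a = a') :
    ((A₀.filter fun a => Valued.v a = 1).card : ℤ) * ∑ r ∈ R with Valued.v r = 1, normSign σ (C₀ + C₁ * (ϖ * σ ϖ) ^ (d - 1) * (r * σ r)) =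
      -(normSign σ C₀ * ((R.filter fun r => Valued.v r = 1).card : ℤ)) := by
  classical
  obtain ⟨hσ, hvσ, hϖ, -, -, -, -⟩ := id hD
  -- the unit classes of `A₀` form a complete irredundant system for the fixed units modulo `|ϖ|²`
  set A := A₀.filter (fun a => Valued.v a = 1) with hAdef
  have hA₁' : ∀ a ∈ A, σ a = a ∧ Valued.v a = 1 := fun a ha => by
    rw [hAdef, Finset.mem_filter] at ha; exact ⟨(hA₁ a ha.1).1, ha.2⟩
  have hϖ2 : Valued.v ϖ ^ 2 < 1 := by
    rw [hϖ, ← exp_nsmul, nsmul_eq_mul, mul_neg, mul_one, ← exp_zero]; exact exp_lt_exp.2 (by norm_num)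
  have hA₂' : ∀ u : K, σ u = u → Valued.v u = 1 → ∃ a ∈ A, Valued.v (u - a) ≤ Valued.v ϖ ^ (2 * 1) := by
    intro u hσu hu1
    obtain ⟨a, ha, hua⟩ := hA₂ u hσu hu1.le
    refine ⟨a, ?_, by rwa [mul_one]⟩
    rw [hAdef, Finset.mem_filter]
    refine ⟨ha, ?_⟩
    rw [show a = u - (u - a) by ring, Valuation.map_sub_eq_of_lt_left _ (by rw [hu1]; exact lt_of_le_of_lt hua hϖ2), hu1]
  have hA₃' : ∀ a ∈ A, ∀ a' ∈ A, Valued.v (a - a') ≤ Valued.v ϖ ^ (2 * 1) → a = a' := fun a ha a' ha' h =>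
    hA₃ a (Finset.mem_filter.1 ha).1 a' (Finset.mem_filter.1 ha').1 (by rwa [mul_one] at h)
  by_cases hAe : A = ∅
  · have hRu : R.filter (fun r => Valued.v r = 1) = ∅ := by
      refine Finset.filter_eq_empty_iff.2 fun r hr hr1 => ?_
      obtain ⟨a, ha, -⟩ := hA₂' (r * σ r) (by rw [map_mul, hσ, mul_comm]) (by rw [map_mul, hvσ, hr1, mul_one])
      rw [hAe] at ha; exact absurd ha (Finset.notMem_empty a)
    simp [hRu, hAe]
  · obtain ⟨a₀, ha₀⟩ := Finset.nonempty_iff_ne_empty.2 hAe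
    have hsum := sum_units_normSign_binaryNormForm_eq_card_mul_sum hD h2v hσC₀ hC₀ hσC₁ hC₁ (j := d - 1) (e := 1) (by omega) (by omega) le_rfl (by omega)
      R hR₁ hR₂ hR₃ A hA₁' hA₂' hA₃' ha₀
    have hcard := card_units_eq_card_mul_card_of_norm_classes hD h2v (e := 1) (by omega) le_rfl (by omega) R hR₁ hR₂ hR₃ A hA₁' hA₂' hA₃' ha₀
    have hunits := sum_units_normSign_affine_repr_conductor hD h2v hσC₀ hC₀ hσC₁ hC₁ hd A₀ hA₁ hA₂ hA₃
    have hone : ((A₀.filter fun a => ¬ Valued.v a = 1).card : ℤ) = 1 := by exact_mod_cast card_filter_not_unit_eq_one hD A₀ hA₁ hA₂ hA₃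
    rw [hone, one_mul] at hunits
    rw [← hAdef] at hunits
    rw [hsum, hunits, hcard]
    ring

end Summit.HodgeConjecture.HodgeConjecture.Cruxes.H413.F0P3cDyRamBinaryNormFormCharCount

end
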